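import Summits.HodgeConjecture.CorCM.Census.OcticTwistCover
import Summits.HodgeConjecture.CorCM.Census.OcticTwistResidualPrep
import Summits.HodgeConjecture.CorCM.Census.QuarticTwistClosing

/-!
# The octic twist `(ℤ/8 × B, (4,0))`, XIII: THE NINE CLOSING FACES and their exact residual reductions

COR-CM (cell `pub-hodgecm2`), count-neutral kernel combinatorics by the binder seat b09 (gen 34; lane COINVARIANT-TWIST / OCTIC RECON,
design step 4 = FACT 5 of `HOME/pub-hodgecm2-b09/lean-g33/COINVARIANT-TWIST.md`), on top of parts I–XII (`Census/OcticTwist*.lean`: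
`tens`, `emb₀`, `IsFace₂`, `exists_flip_atom_eq_cst`, `tens_sum_left`) and the quartic files (`QuarticTwistReduction`: `affine`, `atomVec`,
`Covers`, **`single_sub_affine_mem`**; `QuarticTwistClosing`: `prof`, `corners`, `reg_corners`, **`closing_column`**, **`closing_square`**)
BY NAME.  Theorems only; no definition, no certificate, no named fact, no `sorry`.
HONEST FRAMING: `HC_CM` is NOT proved, here or anywhere in the tree; nothing here is a period or a headline.

SETTING (`|B| = 2m + 1 ≥ 3`, `Q ⊆ B` with `|Q| = m`, `i ≠ j` outside `Q`; `P_x = prof Q i x` the profile types of the quartic closing,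
`P_0 = 𝟙_Q` of regime `0`, `P_1 = 𝟙_{Q+i}` of regime `1`).  Let `N ≤ ℤ^{Ty B × Ty B}` be a submodule whose SLICES
`{v | v ⊗ e_y ∈ N} = N.comap (emb₀ y)` at the small residual passive coordinates `y` (constants, `±1`-atoms) COVER in the quartic sense
(part XI `exists_cover_family'` (i)), and which contains the MIXED SQUARES `(e_{u+kδ_b} − e_u) ⊗ (e_{u′+k′δ_{b′}} − e_{u′})` (ibid. (ii)).
* §1 `single_tens_sub_affine_tens_mem`: on such a slice the quartic AFFINE REDUCTION is exact — `e_{(s,y)} ≡ A_{reg s}(s) ⊗ e_y (mod N)`.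
* §2 `affine_tens_sub_cst_tens_mem`: against a `±1`-atom–constant difference `w = e_{u′+k′δ_{b′}} − e_{u′}` the affine form of a type `s`
  all of whose values are within Lee distance `1` of `u` collapses to its constant: `A_u(s) ⊗ w ≡ e_u ⊗ w` (each atom of `A_u(s)` minus
  `e_u`, against `w`, is a mixed square; the masses add up because `A_u(s)` has total mass `1`).
* §3 THE NINE CLOSING FACES ARE OCTIC FACES (`IsFace₂`): six MIXED faces `(e_{P_0} − e_{P_1}) ⊗ (e_{Δ+kδ_{b₁}} − e_Δ)` (`Δ ∈ {0,1,2}`,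
  `k = ±1`; `P_1 = P_0^{(0,i)}`, `Δ = (Δ + kδ_{b₁})^{(j′,b₁)}`), the coset-`0` COLUMN face `(P_0; (0,i), (1,i)) ⊗ e_0` and the two coset-`0`
  EQUATORIAL faces `(P_0; (0,i), (0,j)) ⊗ e_c`, `c ∈ {0,1}`.
* §4 THEIR EXACT REDUCTIONS (`closing_mixed_mem`, `closing_column_mem`, `closing_square_mem`): modulo `N` as above (plus the face itself),
  `(e_{P_0} − e_{P_1}) ⊗ (e_a − e_Δ) ≡ (e_0 − e_1) ⊗ (e_a − e_Δ)` (§1 at `y = a, Δ`, §2 for the regimes `0, 1`),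
  `(P_0; (0,i),(1,i)) ⊗ e_0 ≡ (X_{1,i} + pair(0) − pair(−δ_i)) ⊗ e_0` (§1 at `y = 0` on the four corners of regimes `0,1,0,1`, then
  `closing_column`), `(P_0; (0,i),(0,j)) ⊗ e_c ≡ (Σ_{q∈Q} X_{0,q} − w_1) ⊗ e_c` (`closing_square`) — i.e. EXACTLY the nine classes
  `hF1`/`hF2`/`hF3` of part XII `closing_moves` (`closing_classes`).  Part XIV (`Census/OcticTwistLaw.lean`) assembles the law.

## References
* [Pohlmann1968] H. Pohlmann, Algebraic cycles on abelian varieties of complex multiplication type, Ann. of Math. 88 (1968), Thm 1.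
-/

namespace Summit.HodgeConjecture.CorCM.Census.OcticTwist

open Finset
open Summit.HodgeConjecture.CorCM.Census.QuarticTwist

variable (B : Type) [AddGroup B] [Fintype B] [DecidableEq B]

/-! ## §1 Exact affine reduction on a covering slice -/

omit [AddGroup B] in
/-- **Slice reduction**: if the slice `{v | v ⊗ e_y ∈ N}` covers, then `e_s ⊗ e_y − A_{reg s}(s) ⊗ e_y ∈ N` for every type `s`
(`|B|` odd, `≥ 3`). [folklore] -/
theorem single_tens_sub_affine_tens_mem (hB : Odd (Fintype.card B)) (h3 : 3 ≤ Fintype.card B) {N : Submodule ℤ (Ty₂ B → ℤ)}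
    {y : Ty B} (hcov : Covers B (N.comap (emb₀ B y))) (s : Ty B) :
    tens B (Pi.single s 1) (Pi.single y 1) - tens B (affine B (reg B s) s) (Pi.single y 1) ∈ N := by
  have h := single_sub_affine_mem B hB h3 hcov s
  rw [Submodule.mem_comap, emb₀_apply, tens_sub_left] at h
  exact h

/-! ## §2 The affine form against an atom–constant difference collapses to its constant -/

omit [AddGroup B] in
/-- Bookkeeping: `A_u(s) ⊗ w − e_u ⊗ w = Σ_b (atomVec u s b − e_u) ⊗ w` (the affine form has total mass `1`). [folklore] -/
theorem affine_tens_sub_cst_tens (u : ZMod 4) (s : Ty B) (w : Ty B → ℤ) :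
    tens B (affine B u s) w - tens B (Pi.single (cst B u) 1) w = ∑ b, tens B (atomVec B u s b - Pi.single (cst B u) 1) w := by
  unfold affine
  rw [tens_sub_left, tens_sum_left, tens_smul_left]
  have hsum : ∑ b, tens B (atomVec B u s b - Pi.single (cst B u) 1) w
      = ∑ b, tens B (atomVec B u s b) w - (Fintype.card B : ℤ) • tens B (Pi.single (cst B u) 1) w := by
    simp only [tens_sub_left, Finset.sum_sub_distrib, Finset.sum_const, Finset.card_univ, natCast_zsmul]
  rw [hsum, sub_smul, one_smul]
  abel

omit [AddGroup B] in
/-- **`A_u(s) ⊗ w ≡ e_u ⊗ w (mod N)`** for `w = e_{u′+k′δ_{b′}} − e_{u′}` (`k′ = ±1`) whenever every value of `s` is within Lee distance `1`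
of `u` and `N` contains the mixed squares `(e_{u+kδ_b} − e_u) ⊗ w` (`k = ±1`). [folklore] -/
theorem affine_tens_sub_cst_tens_mem {N : Submodule ℤ (Ty₂ B → ℤ)}
    (hsq : ∀ (u : ZMod 4) (b : B) (k : ZMod 4) (u' : ZMod 4) (b' : B) (k' : ZMod 4), (k = 1 ∨ k = -1) → (k' = 1 ∨ k' = -1) →
      tens B (Pi.single (atom B u b k) 1 - Pi.single (cst B u) 1) (Pi.single (atom B u' b' k') 1 - Pi.single (cst B u') 1) ∈ N)
    (u : ZMod 4) {s : Ty B} (hs : ∀ b, s b - u = 0 ∨ s b - u = 1 ∨ s b - u = -1) (u' : ZMod 4) (b' : B) {k' : ZMod 4}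
    (hk' : k' = 1 ∨ k' = -1) :
    tens B (affine B u s) (Pi.single (atom B u' b' k') 1 - Pi.single (cst B u') 1)
      - tens B (Pi.single (cst B u) 1) (Pi.single (atom B u' b' k') 1 - Pi.single (cst B u') 1) ∈ N := by
  rw [affine_tens_sub_cst_tens]
  refine Submodule.sum_mem _ fun b _ => ?_
  unfold atomVec
  rcases hs b with h | h
  · rw [h, atom_zero, sub_self]
    have e0 : tens B (0 : Ty B → ℤ) (Pi.single (atom B u' b' k') 1 - Pi.single (cst B u') 1) = 0 := by
      funext T
      simp only [tens, Pi.zero_apply, zero_mul]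
    rw [e0]
    exact Submodule.zero_mem _
  · exact hsq u b (s b - u) u' b' k' h hk'

/-! ## §3 The nine closing faces are octic faces -/

omit [AddGroup B] [Fintype B] in
/-- Values of the profile types `P_0 = 𝟙_Q` (regime `0`) and `P_1 = 𝟙_{Q+i}` (regime `1`) are within Lee distance `1` of the regime. [folklore] -/
theorem prof_sub_reg (Q : Finset B) (i : B) :
    (∀ b, prof B Q i 0 b - 0 = 0 ∨ prof B Q i 0 b - 0 = 1 ∨ prof B Q i 0 b - 0 = -1) ∧
      (∀ b, prof B Q i 1 b - 1 = 0 ∨ prof B Q i 1 b - 1 = 1 ∨ prof B Q i 1 b - 1 = -1) := by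
  refine ⟨fun b => ?_, fun b => ?_⟩
  · unfold prof
    split_ifs
    · exact Or.inr (Or.inl (by decide))
    · exact Or.inl (by decide)
    · exact Or.inl (by decide)
  · unfold prof
    split_ifs
    · exact Or.inl (by decide)
    · exact Or.inl (by decide)
    · exact Or.inr (Or.inr (by decide))

omit [AddGroup B] in
/-- **The six mixed closing faces are octic faces**: `(e_{P_0} − e_{P_1}) ⊗ (e_{Δ+kδ_{b₁}} − e_Δ)` with `P_1 = P_0^{(0,i)}` (`i ∉ Q`) and
`Δ = (Δ+kδ_{b₁})^{(j′,b₁)}` (`k = ±1`). [folklore] -/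
theorem isFace₂_closing_mixed (Q : Finset B) {i : B} (hi : i ∉ Q) (Δ : ZMod 4) (b₁ : B) {k : ZMod 4} (hk : k = 1 ∨ k = -1) :
    IsFace₂ B (tens B (Pi.single (prof B Q i 0) 1 - Pi.single (prof B Q i 1) 1)
      (Pi.single (atom B Δ b₁ k) 1 - Pi.single (cst B Δ) 1)) := by
  obtain ⟨j', hj'⟩ := exists_flip_atom_eq_cst B Δ b₁ hk
  have c1 : QuarticTwist.flip B ((0 : ZMod 2), i) (prof B Q i 0) = prof B Q i 1 := by
    rw [flip_eq_add_single, prof_apply_self B Q hi, step_zero_zero.1, prof_add_single_self B Q hi, zero_add]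
  refine Or.inr (Or.inr ⟨prof B Q i 0, atom B Δ b₁ k, ((0 : ZMod 2), i), (j', b₁), ?_⟩)
  rw [c1, hj']

omit [AddGroup B] in
/-- **The column closing face is an octic face**: `(P_0; (0,i), (1,i)) ⊗ e_t`. [folklore] -/
theorem isFace₂_closing_column (Q : Finset B) (i : B) (t : Ty B) :
    IsFace₂ B (tens B (faceVec B (prof B Q i 0) ((0 : ZMod 2), i) ((1 : ZMod 2), i)) (Pi.single t 1)) :=
  Or.inl ⟨prof B Q i 0, t, ((0 : ZMod 2), i), ((1 : ZMod 2), i),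
    fun h => zero_ne_one ((Prod.ext_iff.mp h).1 : (0 : ZMod 2) = 1), rfl⟩

omit [AddGroup B] in
/-- **The equatorial closing faces are octic faces**: `(P_0; (0,i), (0,j)) ⊗ e_t` (`j ≠ i`). [folklore] -/
theorem isFace₂_closing_square (Q : Finset B) {i j : B} (hji : j ≠ i) (t : Ty B) :
    IsFace₂ B (tens B (faceVec B (prof B Q i 0) ((0 : ZMod 2), i) ((0 : ZMod 2), j)) (Pi.single t 1)) :=
  Or.inl ⟨prof B Q i 0, t, ((0 : ZMod 2), i), ((0 : ZMod 2), j), fun h => hji ((Prod.ext_iff.mp h).2).symm, rfl⟩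

/-! ## §4 The exact reductions of the nine closing faces -/

omit [AddGroup B] in
/-- **REDUCTION OF A MIXED CLOSING FACE** (`|B| = 2m+1`, `m ≥ 1`, `|Q| = m`, `i ≠ j` outside `Q`; `a = Δ + kδ_{b₁}`, `k = ±1`).  If the slices
of `N` at `a` and at `Δ` cover, `N` contains the mixed squares and the face `(e_{P_0} − e_{P_1}) ⊗ (e_a − e_Δ)`, then
`(e_0 − e_1) ⊗ (e_Δ − e_a) ∈ N`. [folklore] -/
theorem closing_mixed_mem (hB : Odd (Fintype.card B)) {m : ℕ} (hm : Fintype.card B = 2 * m + 1) (h1 : 1 ≤ m)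
    {Q : Finset B} (hQ : Q.card = m) {i j : B} (hi : i ∉ Q) (hj : j ∉ Q) (hji : j ≠ i) {N : Submodule ℤ (Ty₂ B → ℤ)}
    (hsq : ∀ (u : ZMod 4) (b : B) (k : ZMod 4) (u' : ZMod 4) (b' : B) (k' : ZMod 4), (k = 1 ∨ k = -1) → (k' = 1 ∨ k' = -1) →
      tens B (Pi.single (atom B u b k) 1 - Pi.single (cst B u) 1) (Pi.single (atom B u' b' k') 1 - Pi.single (cst B u') 1) ∈ N)
    (Δ : ZMod 4) (b₁ : B) {k : ZMod 4} (hk : k = 1 ∨ k = -1)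
    (hcovA : Covers B (N.comap (emb₀ B (atom B Δ b₁ k)))) (hcovC : Covers B (N.comap (emb₀ B (cst B Δ))))
    (hF : tens B (Pi.single (prof B Q i 0) 1 - Pi.single (prof B Q i 1) 1) (Pi.single (atom B Δ b₁ k) 1 - Pi.single (cst B Δ) 1) ∈ N) :
    tens B (Pi.single (cst B 0) 1 - Pi.single (cst B 1) 1) (Pi.single (cst B Δ) 1 - Pi.single (atom B Δ b₁ k) 1) ∈ N := by
  have h3 : 3 ≤ Fintype.card B := by omega
  obtain ⟨r0, r1, -, -, -, -⟩ := reg_corners B hB hm h1 Q hQ hi hj hji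
  -- slice reductions of the four corner terms
  have sA0 := single_tens_sub_affine_tens_mem B hB h3 hcovA (prof B Q i 0)
  have sA1 := single_tens_sub_affine_tens_mem B hB h3 hcovA (prof B Q i 1)
  have sC0 := single_tens_sub_affine_tens_mem B hB h3 hcovC (prof B Q i 0)
  have sC1 := single_tens_sub_affine_tens_mem B hB h3 hcovC (prof B Q i 1)
  rw [r0] at sA0 sC0
  rw [r1] at sA1 sC1
  -- collapse of the two affine forms against `e_a − e_Δ`
  obtain ⟨hs0, hs1⟩ := prof_sub_reg B Q i
  have a0 := affine_tens_sub_cst_tens_mem B hsq 0 hs0 Δ b₁ hk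
  have a1 := affine_tens_sub_cst_tens_mem B hsq 1 hs1 Δ b₁ hk
  -- the identity
  have e : tens B (Pi.single (cst B 0) 1 - Pi.single (cst B 1) 1) (Pi.single (cst B Δ) 1 - Pi.single (atom B Δ b₁ k) 1)
      = -(tens B (Pi.single (prof B Q i 0) 1 - Pi.single (prof B Q i 1) 1) (Pi.single (atom B Δ b₁ k) 1 - Pi.single (cst B Δ) 1)
        - (tens B (Pi.single (prof B Q i 0) 1) (Pi.single (atom B Δ b₁ k) 1) - tens B (affine B 0 (prof B Q i 0)) (Pi.single (atom B Δ b₁ k) 1))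
        + (tens B (Pi.single (prof B Q i 1) 1) (Pi.single (atom B Δ b₁ k) 1) - tens B (affine B 1 (prof B Q i 1)) (Pi.single (atom B Δ b₁ k) 1))
        + (tens B (Pi.single (prof B Q i 0) 1) (Pi.single (cst B Δ) 1) - tens B (affine B 0 (prof B Q i 0)) (Pi.single (cst B Δ) 1))
        - (tens B (Pi.single (prof B Q i 1) 1) (Pi.single (cst B Δ) 1) - tens B (affine B 1 (prof B Q i 1)) (Pi.single (cst B Δ) 1))
        - (tens B (affine B 0 (prof B Q i 0)) (Pi.single (atom B Δ b₁ k) 1 - Pi.single (cst B Δ) 1)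
            - tens B (Pi.single (cst B 0) 1) (Pi.single (atom B Δ b₁ k) 1 - Pi.single (cst B Δ) 1))
        + (tens B (affine B 1 (prof B Q i 1)) (Pi.single (atom B Δ b₁ k) 1 - Pi.single (cst B Δ) 1)
            - tens B (Pi.single (cst B 1) 1) (Pi.single (atom B Δ b₁ k) 1 - Pi.single (cst B Δ) 1))) := by
    funext T
    simp only [tens, Pi.add_apply, Pi.sub_apply, Pi.neg_apply]
    ring
  rw [e]
  refine Submodule.neg_mem _ ?_
  exact Submodule.add_mem _ (Submodule.sub_mem _ (Submodule.sub_mem _ (Submodule.add_mem _ (Submodule.add_mem _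
    (Submodule.sub_mem _ hF sA0) sA1) sC0) sC1) a0) a1

omit [AddGroup B] in
/-- **REDUCTION OF THE COLUMN CLOSING FACE** (`|B| = 2m+1`, `m ≥ 1`, `|Q| = m`, `i ≠ j` outside `Q`).  If the slice of `N` at the constant `0`
covers and `N` contains `(P_0; (0,i), (1,i)) ⊗ e_0`, then `(X_{1,i} + pair(0) − pair(−δ_i)) ⊗ e_0 ∈ N` (the four corners have the regimes
`0, 1, 0, 1`; `closing_column`). [folklore] -/
theorem closing_column_mem (hB : Odd (Fintype.card B)) {m : ℕ} (hm : Fintype.card B = 2 * m + 1) (h1 : 1 ≤ m)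
    {Q : Finset B} (hQ : Q.card = m) {i j : B} (hi : i ∉ Q) (hj : j ∉ Q) (hji : j ≠ i) {N : Submodule ℤ (Ty₂ B → ℤ)}
    (hcov0 : Covers B (N.comap (emb₀ B (cst B 0))))
    (hF : tens B (faceVec B (prof B Q i 0) ((0 : ZMod 2), i) ((1 : ZMod 2), i)) (Pi.single (cst B 0) 1) ∈ N) :
    tens B (Xvec B 1 i + pairVec B (cst B 0) - pairVec B (atom B 0 i (-1))) (Pi.single (cst B 0) 1) ∈ N := by
  have h3 : 3 ≤ Fintype.card B := by omega
  obtain ⟨c1, c2, c12, -, -⟩ := corners B Q hi hj hji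
  obtain ⟨r0, r1, rm1, r2, -, -⟩ := reg_corners B hB hm h1 Q hQ hi hj hji
  have s0 := single_tens_sub_affine_tens_mem B hB h3 hcov0 (prof B Q i 0)
  have s1 := single_tens_sub_affine_tens_mem B hB h3 hcov0 (prof B Q i 1)
  have sm1 := single_tens_sub_affine_tens_mem B hB h3 hcov0 (prof B Q i (-1))
  have s2 := single_tens_sub_affine_tens_mem B hB h3 hcov0 (prof B Q i 2)
  rw [r0] at s0
  rw [r1] at s1
  rw [rm1] at sm1
  rw [r2] at s2
  have e : tens B (Xvec B 1 i + pairVec B (cst B 0) - pairVec B (atom B 0 i (-1))) (Pi.single (cst B 0) 1)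
      = tens B (faceVec B (prof B Q i 0) ((0 : ZMod 2), i) ((1 : ZMod 2), i)) (Pi.single (cst B 0) 1)
        - (tens B (Pi.single (prof B Q i 0) 1) (Pi.single (cst B 0) 1) - tens B (affine B 0 (prof B Q i 0)) (Pi.single (cst B 0) 1))
        + (tens B (Pi.single (prof B Q i 1) 1) (Pi.single (cst B 0) 1) - tens B (affine B 1 (prof B Q i 1)) (Pi.single (cst B 0) 1))
        + (tens B (Pi.single (prof B Q i (-1)) 1) (Pi.single (cst B 0) 1) - tens B (affine B 0 (prof B Q i (-1))) (Pi.single (cst B 0) 1))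
        - (tens B (Pi.single (prof B Q i 2) 1) (Pi.single (cst B 0) 1) - tens B (affine B 1 (prof B Q i 2)) (Pi.single (cst B 0) 1)) := by
    rw [← closing_column B Q hi]
    unfold faceVec
    rw [c12, c1, c2]
    funext T
    simp only [tens, Pi.add_apply, Pi.sub_apply]
    ring
  rw [e]
  exact Submodule.sub_mem _ (Submodule.add_mem _ (Submodule.add_mem _ (Submodule.sub_mem _ hF s0) s1) sm1) s2

omit [AddGroup B] in
/-- **REDUCTION OF AN EQUATORIAL CLOSING FACE** (`|B| = 2m+1`, `m ≥ 1`, `|Q| = m`, `i ≠ j` outside `Q`).  If the slice of `N` at the constant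
`c` covers and `N` contains `(P_0; (0,i), (0,j)) ⊗ e_c`, then `(Σ_{q∈Q} X_{0,q} − w_1) ⊗ e_c ∈ N` (the four corners have the regimes
`0, 1, 1, 1`; `closing_square`). [folklore] -/
theorem closing_square_mem (hB : Odd (Fintype.card B)) {m : ℕ} (hm : Fintype.card B = 2 * m + 1) (h1 : 1 ≤ m)
    {Q : Finset B} (hQ : Q.card = m) {i j : B} (hi : i ∉ Q) (hj : j ∉ Q) (hji : j ≠ i) {N : Submodule ℤ (Ty₂ B → ℤ)}
    (c : Ty B) (hcov : Covers B (N.comap (emb₀ B c)))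
    (hF : tens B (faceVec B (prof B Q i 0) ((0 : ZMod 2), i) ((0 : ZMod 2), j)) (Pi.single c 1) ∈ N) :
    tens B ((∑ q ∈ Q, Xvec B 0 q) - Wvec B 1) (Pi.single c 1) ∈ N := by
  have h3 : 3 ≤ Fintype.card B := by omega
  obtain ⟨c1, -, -, cj, cij⟩ := corners B Q hi hj hji
  obtain ⟨r0, r1, -, -, rj0, rj1⟩ := reg_corners B hB hm h1 Q hQ hi hj hji
  have s0 := single_tens_sub_affine_tens_mem B hB h3 hcov (prof B Q i 0)
  have s1 := single_tens_sub_affine_tens_mem B hB h3 hcov (prof B Q i 1)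
  have sj0 := single_tens_sub_affine_tens_mem B hB h3 hcov (prof B (insert j Q) i 0)
  have sj1 := single_tens_sub_affine_tens_mem B hB h3 hcov (prof B (insert j Q) i 1)
  rw [r0] at s0
  rw [r1] at s1
  rw [rj0] at sj0
  rw [rj1] at sj1
  have e : tens B ((∑ q ∈ Q, Xvec B 0 q) - Wvec B 1) (Pi.single c 1)
      = tens B (faceVec B (prof B Q i 0) ((0 : ZMod 2), i) ((0 : ZMod 2), j)) (Pi.single c 1)
        - (tens B (Pi.single (prof B Q i 0) 1) (Pi.single c 1) - tens B (affine B 0 (prof B Q i 0)) (Pi.single c 1))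
        + (tens B (Pi.single (prof B Q i 1) 1) (Pi.single c 1) - tens B (affine B 1 (prof B Q i 1)) (Pi.single c 1))
        + (tens B (Pi.single (prof B (insert j Q) i 0) 1) (Pi.single c 1) - tens B (affine B 1 (prof B (insert j Q) i 0)) (Pi.single c 1))
        - (tens B (Pi.single (prof B (insert j Q) i 1) 1) (Pi.single c 1) - tens B (affine B 1 (prof B (insert j Q) i 1)) (Pi.single c 1)) := by
    rw [← closing_square B Q hi hj hji]
    unfold faceVec
    rw [cij, c1, cj]
    funext T
    simp only [tens, Pi.add_apply, Pi.sub_apply]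
    ring
  rw [e]
  exact Submodule.sub_mem _ (Submodule.add_mem _ (Submodule.add_mem _ (Submodule.sub_mem _ hF s0) s1) sj0) sj1

omit [AddGroup B] in
/-- **THE NINE CLASSES OF THE CLOSING** (`|B| = 2m+1`, `m ≥ 1`, `|Q| = m`, `i ≠ j` outside `Q`, `b₁` any column).  Let `N` contain the mixed
squares, let its slices `{v | v ⊗ e_y ∈ N}` at every small residual `y` cover, and let `N` contain the nine closing faces: the six mixed faces
`(e_{P_0} − e_{P_1}) ⊗ (e_{Δ+kδ_{b₁}} − e_Δ)` (`Δ ∈ {0,1,2}`, `k = ±1`), the column face `(P_0; (0,i),(1,i)) ⊗ e_0` and the equatorial faces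
`(P_0; (0,i),(0,j)) ⊗ e_c` (`c ∈ {0,1}`).  Then `N` contains the nine classes `hF1`, `hF2`, `hF3` of part XII `closing_moves`. [folklore] -/
theorem closing_classes (hB : Odd (Fintype.card B)) {m : ℕ} (hm : Fintype.card B = 2 * m + 1) (h1 : 1 ≤ m)
    {Q : Finset B} (hQ : Q.card = m) {i j : B} (hi : i ∉ Q) (hj : j ∉ Q) (hji : j ≠ i) (b₁ : B) {N : Submodule ℤ (Ty₂ B → ℤ)}
    (hsq : ∀ (u : ZMod 4) (b : B) (k : ZMod 4) (u' : ZMod 4) (b' : B) (k' : ZMod 4), (k = 1 ∨ k = -1) → (k' = 1 ∨ k' = -1) →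
      tens B (Pi.single (atom B u b k) 1 - Pi.single (cst B u) 1) (Pi.single (atom B u' b' k') 1 - Pi.single (cst B u') 1) ∈ N)
    (hcov : ∀ y : Ty B, IsRes B y → (¬ ∃ (u : ZMod 4) (b : B), y = atom B u b 2) → Covers B (N.comap (emb₀ B y)))
    (hM : ∀ Δ k : ZMod 4, (Δ = 0 ∨ Δ = 1 ∨ Δ = 2) → (k = 1 ∨ k = -1) →
      tens B (Pi.single (prof B Q i 0) 1 - Pi.single (prof B Q i 1) 1) (Pi.single (atom B Δ b₁ k) 1 - Pi.single (cst B Δ) 1) ∈ N)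
    (hC : tens B (faceVec B (prof B Q i 0) ((0 : ZMod 2), i) ((1 : ZMod 2), i)) (Pi.single (cst B 0) 1) ∈ N)
    (hE : ∀ c : ZMod 4, (c = 0 ∨ c = 1) → tens B (faceVec B (prof B Q i 0) ((0 : ZMod 2), i) ((0 : ZMod 2), j)) (Pi.single (cst B c) 1) ∈ N) :
    (∀ Δ k : ZMod 4, (Δ = 0 ∨ Δ = 1 ∨ Δ = 2) → (k = 1 ∨ k = -1) →
      tens B (Pi.single (cst B 0) 1 - Pi.single (cst B 1) 1) (Pi.single (cst B Δ) 1 - Pi.single (atom B Δ b₁ k) 1) ∈ N) ∧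
    tens B (Xvec B 1 i + pairVec B (cst B 0) - pairVec B (atom B 0 i (-1))) (Pi.single (cst B 0) 1) ∈ N ∧
    (∀ c : ZMod 4, (c = 0 ∨ c = 1) → tens B ((∑ q ∈ Q, Xvec B 0 q) - Wvec B 1) (Pi.single (cst B c) 1) ∈ N) := by
  have h3 : 3 ≤ Fintype.card B := by omega
  have pm1 : ∀ {k : ZMod 4}, (k = 1 ∨ k = -1) → k ≠ 0 := fun hk => by
    rcases hk with rfl | rfl <;> decide
  -- the slices at the constants and at the `±1`-atoms cover
  have hcst : ∀ u : ZMod 4, Covers B (N.comap (emb₀ B (cst B u))) := fun u =>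
    hcov _ ⟨u, b₁, 0, (atom_zero B u b₁).symm⟩ (fun ⟨u', b, h⟩ => atom_ne_cst B h3 (by decide) u h.symm)
  have hatm : ∀ (Δ : ZMod 4) (k : ZMod 4), (k = 1 ∨ k = -1) → Covers B (N.comap (emb₀ B (atom B Δ b₁ k))) := fun Δ k hk =>
    hcov _ ⟨Δ, b₁, k, rfl⟩ (fun ⟨u', b, h⟩ => by
      have h2 := ((atom_eq_atom_iff B h3 (pm1 hk)).mp h).2.2
      rcases hk with rfl | rfl
      · exact absurd h2 (by decide)
      · exact absurd h2 (by decide))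
  refine ⟨fun Δ k hΔ hk => ?_, ?_, fun c hc => ?_⟩
  · exact closing_mixed_mem B hB hm h1 hQ hi hj hji hsq Δ b₁ hk (hatm Δ k hk) (hcst Δ) (hM Δ k hΔ hk)
  · exact closing_column_mem B hB hm h1 hQ hi hj hji (hcst 0) hC
  · exact closing_square_mem B hB hm h1 hQ hi hj hji (cst B c) (hcst c) (hE c hc)

end Summit.HodgeConjecture.CorCM.Census.OcticTwist
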